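import Summits.QuantumFields.YangMills.Theorems.BalabanUVNodesPortS1LocPowPolymer
import Literature.Analysis.InnerProduct.KroneckerOperatorNorm

/-!
# NODE O port PT-A — THE POWER MEMBERS OF (63), LOCALIZED, PART C: the SCHUR TEST feeding the operator-norm hypothesis of PART B, the touching-sum hypothesis DISCHARGED on the
# torus `𝐃_j` (the tree's (1.26) `ineq126_touches` + the volume law), and THE SERIES `Σ_{n≥1} ((−1)ⁿ∕2n) R⁻ⁿ · (piece of X in Tr Tⁿ)`: summable, `LogHalfBound`-shaped, and resumming to
# `Σ_{n≥1} ((−1)ⁿ∕2n) R⁻ⁿ Tr Tⁿ` — the power half of [16] (63) at a field-localized operator family `T = Σ_Y T_Y` is a sum of EXPONENTIALLY LOCALIZED PIECES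

Cell `ym-nodeO-ideate`, porter seat `ymgap-nodeO-port-PTA-1` (gen 7); `--supports stmt-QuantumFields-27930` (helper, P0-free).  [16] = [Balaban1985UV3], [I] = [Balaban1987RG1],
[II] = [Balaban1988RG2Cluster].  Continues ✓`…PortS1LocPowExpansion` (PART A: `Tr (Σ_i T_i)ᵐ = Σ_U locPowPiece … m U`) and ✓`…PortS1LocPowPolymer` (PART B: the polymer ∕ tree-decay bound
`‖locPowPiece … m U‖ ≤ N_U cᵐ e^{δ(m−1)} e^{−(δ∕2)d(U)} Kᵐ |U|` under an operator-norm decay of the pieces and a touching-sum hypothesis).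

WHY.  In the v3.3 glue `lzdetHalf_of_P0C_G3C` of 27930's line `pta-residueW` ([16] (63) at the record's preconditioned fluctuation operator: `−½ log det T = ½∫₀^R Tr(T + x)⁻¹dx − ½ Tr 1·log R +
Σ_{n≥1} ((−1)ⁿ∕2n) R⁻ⁿ Tr Tⁿ`, ✓`B10LogDet63.matrix63`, `R = 2γ₁` FREE above the spectrum) the P0-ℂ letter delivers the carrier as a sum of localized pieces `T_Y` with SCHUR row∕column bounds
`c₀ e^{−δ₀ d(Y)}` (consumer clause (P4), (c6a)); this file turns that input into what the residue format wants from the power members, with NO P0 content: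
* §1 `l2_opNorm_le_of_row_col_sum` — the Schur test for the `ℓ²`-operator norm of a complex matrix (row sums and column sums of `‖A i j‖` at most `M` ⇒ `‖A‖ ≤ M`; weighted Cauchy–Schwarz
  + the tree's bound principle `l2_opNorm_le_of_forall_norm_mulVec_le`).
* §2 `touchSum_torus_le` — PART B's touching-sum hypothesis ON THE TORUS: `Σ_{X ∈ 𝐃, X ∩ Y ≠ ∅} e^{−(δ∕2) d(X)}·|X| ≤ 4·2^d·K₀(4·2^d, 2d)·|Y|` as soon as `κ₀(4·2^d, 2d) ≤ δ∕2 − 1`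
  (✓`B12TreeDecay.ineq126_touches` at `tcubeSys`, ✓`card_le_torusTreeLen`, `1 + d ≤ e^d`).
* §3 `coef63`, `powMemberPiece supp T R U := Σ'_j coef63 R j · locPowPiece supp T (j+1) U`; ★★ `norm_term63_le` ∕ `summable_powMemberPiece` ∕ `norm_powMemberPiece_le` — for `R ≥ 2·c·K·e^{δ}` the series
  converges absolutely with `‖powMemberPiece … U‖ ≤ ½ N_U |U| e^{−(δ∕2) d(U)}`; ★★★ `sum_powMemberPiece_eq` — `Σ_{X ∈ 𝐃} powMemberPiece … X = Σ'_j coef63 R j · Tr (Σ_i T_i)^{j+1}` (the localized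
  pieces RESUM to the power half of (63); non-domains carry nothing, PART A).

HONEST FRAMING.  Generic finite-dimensional analysis (any finite index types, any torus `(ℤ∕N)^d` of cubes); NOTHING of Bałaban's estimates asserted or proved; the record instantiation (the
letter's `TY`, the radius `R = 2γ₁'`) is the glue's; `stub_LZdet` ∕ `stub_FE` OPEN; 27930 OPEN · 2∕4 stubs by name · no claim; NODE O 0∕1; COUNT 8∕28 · K 1∕4 UNMOVED; finite `𝕋⁴_{L^K}` at fixed
ε — NOT continuum ∕ OS ∕ Clay; **the Yang–Mills mass gap is NOT proved by any of this.**  No `sorry`, no `instance`, no `notation`; two small `def`s (`coef63`, `powMemberPiece`); standard axioms.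
-/

open scoped BigOperators Matrix.Norms.L2Operator
open Finset

namespace Summit.QuantumFields.YangMills.Theorems.BalabanUVNodesPortS1

open Literature.MathematicalPhysics.QuantumFieldTheory.Balaban1983to89
open Literature.MathematicalPhysics.QuantumFieldTheory.Balaban1983to89.TreeLengthTorus (TPt IsTDom TDom TFaceConnected torusTreeLen torusTreeLen_nonneg tsys tcubeSys
  card_le_torusTreeLen tdegreeLE tvolumeLeaf)
open Literature.MathematicalPhysics.QuantumFieldTheory.Balaban1983to89.B12TreeDecay (K₀ kappa₀)

/-! ## §1  The Schur test for the `ℓ²`-operator norm -/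

section Schur

variable {m n : Type*} [Fintype m] [Fintype n]

/-- Weighted Cauchy–Schwarz: for a non-negative kernel `k`, `Σ_{i,j} k_{ij} u_i w_j ≤ √(Σ_{i,j} k_{ij} u_i²) · √(Σ_{i,j} k_{ij} w_j²)`. [folklore] -/
theorem sum_sum_mul_le_sqrt_mul_sqrt (k : m → n → ℝ) (hk : ∀ i j, 0 ≤ k i j) (u : m → ℝ) (w : n → ℝ) :
    ∑ i, ∑ j, k i j * (u i * w j) ≤ Real.sqrt (∑ i, ∑ j, k i j * u i ^ 2) * Real.sqrt (∑ i, ∑ j, k i j * w j ^ 2) := by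
  have hcs := sum_mul_sq_le_sq_mul_sq (univ : Finset (m × n)) (fun p => Real.sqrt (k p.1 p.2) * u p.1) (fun p => Real.sqrt (k p.1 p.2) * w p.2)
  have h1 : ∑ p : m × n, Real.sqrt (k p.1 p.2) * u p.1 * (Real.sqrt (k p.1 p.2) * w p.2) = ∑ i, ∑ j, k i j * (u i * w j) := by
    rw [← univ_product_univ, sum_product]
    refine sum_congr rfl fun i _ => sum_congr rfl fun j _ => ?_
    have := Real.mul_self_sqrt (hk i j)
    calc Real.sqrt (k i j) * u i * (Real.sqrt (k i j) * w j) = (Real.sqrt (k i j) * Real.sqrt (k i j)) * (u i * w j) := by ring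
      _ = k i j * (u i * w j) := by rw [this]
  have h2 : ∑ p : m × n, (Real.sqrt (k p.1 p.2) * u p.1) ^ 2 = ∑ i, ∑ j, k i j * u i ^ 2 := by
    rw [← univ_product_univ, sum_product]
    refine sum_congr rfl fun i _ => sum_congr rfl fun j _ => ?_
    rw [mul_pow, Real.sq_sqrt (hk i j)]
  have h3 : ∑ p : m × n, (Real.sqrt (k p.1 p.2) * w p.2) ^ 2 = ∑ i, ∑ j, k i j * w j ^ 2 := by
    rw [← univ_product_univ, sum_product]
    refine sum_congr rfl fun i _ => sum_congr rfl fun j _ => ?_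
    rw [mul_pow, Real.sq_sqrt (hk i j)]
  rw [h1, h2, h3] at hcs
  have hA : 0 ≤ ∑ i, ∑ j, k i j * u i ^ 2 := sum_nonneg fun i _ => sum_nonneg fun j _ => mul_nonneg (hk i j) (sq_nonneg _)
  have hB : 0 ≤ ∑ i, ∑ j, k i j * w j ^ 2 := sum_nonneg fun i _ => sum_nonneg fun j _ => mul_nonneg (hk i j) (sq_nonneg _)
  rw [← Real.sqrt_mul hA]
  exact Real.le_sqrt_of_sq_le hcs

/-- ★ **THE SCHUR TEST for the `ℓ²`-operator norm of a complex matrix**: if every row sum and every column sum of `‖A i j‖` is at most `M ≥ 0`, then `‖A‖ ≤ M`. [folklore] -/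
theorem l2_opNorm_le_of_row_col_sum [DecidableEq n] (A : Matrix m n ℂ) {M : ℝ} (hM : 0 ≤ M)
    (hrow : ∀ i, ∑ j, ‖A i j‖ ≤ M) (hcol : ∀ j, ∑ i, ‖A i j‖ ≤ M) : ‖A‖ ≤ M := by
  refine Literature.Analysis.InnerProduct.l2_opNorm_le_of_forall_norm_mulVec_le A hM fun v => ?_
  show ‖(WithLp.toLp 2 (A.mulVec (WithLp.ofLp v)) : EuclideanSpace ℂ m)‖ ≤ M * ‖v‖
  set Av : EuclideanSpace ℂ m := WithLp.toLp 2 (A.mulVec (WithLp.ofLp v)) with hAv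
  -- ‖Av‖² ≤ Σ_{i,j} ‖A i j‖ ‖(Av) i‖ ‖v j‖ ≤ M ‖Av‖ ‖v‖
  have hsq : ‖Av‖ ^ 2 ≤ ∑ i, ∑ j, ‖A i j‖ * (‖Av i‖ * ‖v j‖) := by
    rw [EuclideanSpace.norm_sq_eq]
    refine sum_le_sum fun i _ => ?_
    have hi : Av i = ∑ j, A i j * v j := rfl
    calc ‖Av i‖ ^ 2 = ‖Av i‖ * ‖∑ j, A i j * v j‖ := by rw [sq, ← hi]
      _ ≤ ‖Av i‖ * ∑ j, ‖A i j‖ * ‖v j‖ := by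
          refine mul_le_mul_of_nonneg_left ((norm_sum_le _ _).trans (sum_le_sum fun j _ => ?_)) (norm_nonneg _)
          rw [norm_mul]
      _ = ∑ j, ‖A i j‖ * (‖Av i‖ * ‖v j‖) := by rw [mul_sum]; exact sum_congr rfl fun j _ => by ring
  have hcs := sum_sum_mul_le_sqrt_mul_sqrt (fun i j => ‖A i j‖) (fun i j => norm_nonneg _) (fun i => ‖Av i‖) (fun j => ‖v j‖)
  have hA : ∑ i, ∑ j, ‖A i j‖ * ‖Av i‖ ^ 2 ≤ M * ‖Av‖ ^ 2 := by
    rw [EuclideanSpace.norm_sq_eq Av, mul_sum]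
    refine sum_le_sum fun i _ => ?_
    rw [← sum_mul]
    exact (mul_le_mul_of_nonneg_left (hrow i) (sq_nonneg _)).trans_eq' (mul_comm _ _) |>.trans_eq (mul_comm _ _)
  have hB : ∑ i, ∑ j, ‖A i j‖ * ‖v j‖ ^ 2 ≤ M * ‖v‖ ^ 2 := by
    rw [sum_comm, EuclideanSpace.norm_sq_eq v, mul_sum]
    refine sum_le_sum fun j _ => ?_
    rw [← sum_mul]
    exact (mul_le_mul_of_nonneg_left (hcol j) (sq_nonneg _)).trans_eq' (mul_comm _ _) |>.trans_eq (mul_comm _ _)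
  have h1 : Real.sqrt (∑ i, ∑ j, ‖A i j‖ * ‖Av i‖ ^ 2) ≤ Real.sqrt M * ‖Av‖ :=
    calc Real.sqrt (∑ i, ∑ j, ‖A i j‖ * ‖Av i‖ ^ 2) ≤ Real.sqrt (M * ‖Av‖ ^ 2) := Real.sqrt_le_sqrt hA
      _ = Real.sqrt M * ‖Av‖ := by rw [Real.sqrt_mul hM, Real.sqrt_sq (norm_nonneg _)]
  have h2 : Real.sqrt (∑ i, ∑ j, ‖A i j‖ * ‖v j‖ ^ 2) ≤ Real.sqrt M * ‖v‖ :=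
    calc Real.sqrt (∑ i, ∑ j, ‖A i j‖ * ‖v j‖ ^ 2) ≤ Real.sqrt (M * ‖v‖ ^ 2) := Real.sqrt_le_sqrt hB
      _ = Real.sqrt M * ‖v‖ := by rw [Real.sqrt_mul hM, Real.sqrt_sq (norm_nonneg _)]
  have hkey : ‖Av‖ ^ 2 ≤ M * ‖Av‖ * ‖v‖ := by
    calc ‖Av‖ ^ 2 ≤ _ := hsq
      _ ≤ _ := hcs
      _ ≤ (Real.sqrt M * ‖Av‖) * (Real.sqrt M * ‖v‖) :=
          mul_le_mul h1 h2 (Real.sqrt_nonneg _) (by positivity)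
      _ = M * ‖Av‖ * ‖v‖ := by
          have := Real.mul_self_sqrt hM
          calc (Real.sqrt M * ‖Av‖) * (Real.sqrt M * ‖v‖) = (Real.sqrt M * Real.sqrt M) * ‖Av‖ * ‖v‖ := by ring
            _ = M * ‖Av‖ * ‖v‖ := by rw [this]
  by_cases h0 : ‖Av‖ = 0
  · rw [h0]; positivity
  · have hpos : 0 < ‖Av‖ := lt_of_le_of_ne (norm_nonneg _) (Ne.symm h0)
    have hkey' : ‖Av‖ * ‖Av‖ ≤ (M * ‖v‖) * ‖Av‖ := by rw [← sq]; linarith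
    exact le_of_mul_le_mul_right hkey' hpos

end Schur

/-! ## §2  The touching-sum hypothesis of PART B, discharged on the torus -/

section Touch

variable {d N : ℕ} [NeZero N]

/-- `|X| · e^{−(δ∕2) d(X)} ≤ 4·2^d · e^{−(δ∕2 − 1) d(X)}` for a torus localization domain (`|X| ≤ 2^d(4d(X) + 1) ≤ 4·2^d·e^{d(X)}`). [cite: Balaban1988RG2Cluster, (2.30) p.18] -/
theorem card_mul_exp_le (δ : ℝ) (X : TDom d N) :
    Real.exp (-(δ / 2 * torusTreeLen X.1)) * (X.1.card : ℝ) ≤ 4 * 2 ^ d * Real.exp (-((δ / 2 - 1) * torusTreeLen X.1)) := by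
  have hcard := card_le_torusTreeLen X.2.1 X.2.2
  have hd0 := torusTreeLen_nonneg X.1
  have hexp : 4 * torusTreeLen X.1 + 1 ≤ 4 * Real.exp (torusTreeLen X.1) := by
    have := Real.add_one_le_exp (torusTreeLen X.1)
    linarith
  have h2d : (0 : ℝ) < 2 ^ d := by positivity
  have hsplit : Real.exp (-((δ / 2 - 1) * torusTreeLen X.1)) = Real.exp (-(δ / 2 * torusTreeLen X.1)) * Real.exp (torusTreeLen X.1) := by
    rw [← Real.exp_add]; congr 1; ring
  rw [hsplit]
  calc Real.exp (-(δ / 2 * torusTreeLen X.1)) * (X.1.card : ℝ)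
      ≤ Real.exp (-(δ / 2 * torusTreeLen X.1)) * (2 ^ d * (4 * torusTreeLen X.1 + 1)) :=
        mul_le_mul_of_nonneg_left hcard (Real.exp_nonneg _)
    _ ≤ Real.exp (-(δ / 2 * torusTreeLen X.1)) * (2 ^ d * (4 * Real.exp (torusTreeLen X.1))) :=
        mul_le_mul_of_nonneg_left (mul_le_mul_of_nonneg_left hexp h2d.le) (Real.exp_nonneg _)
    _ = 4 * 2 ^ d * (Real.exp (-(δ / 2 * torusTreeLen X.1)) * Real.exp (torusTreeLen X.1)) := by ring

/-- ★ **THE TOUCHING SUM ON THE TORUS**: for `κ₀(4·2^d, 2d) ≤ δ∕2 − 1` and every finite set `Y` of cubes,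
`Σ_{X ∈ 𝐃, X ∩ Y ≠ ∅} e^{−(δ∕2) d(X)}·|X| ≤ 4·2^d·K₀(4·2^d, 2d)·|Y|` (the hypothesis `hcount` of PART B with `supp = Subtype.val`). [cite: Balaban1988RG2Cluster, (1.26) p.8, (2.30) p.18; Dimock2013, App. A Cor. 26] -/
theorem touchSum_torus_le {δ : ℝ} (hδ : kappa₀ (4 * 2 ^ d) (2 * d) ≤ δ / 2 - 1) (Y : Finset (TPt d N)) :
    ∑ X ∈ univ.filter (fun X : TDom d N => (X.1 ∩ Y).Nonempty), Real.exp (-(δ / 2 * torusTreeLen X.1)) * (X.1.card : ℝ)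
      ≤ 4 * 2 ^ d * K₀ (4 * 2 ^ d) (2 * d) * Y.card := by
  have h126 := B12TreeDecay.ineq126_touches (tcubeSys d N) (tdegreeLE d N) (tvolumeLeaf d N) hδ Y
  calc ∑ X ∈ univ.filter (fun X : TDom d N => (X.1 ∩ Y).Nonempty), Real.exp (-(δ / 2 * torusTreeLen X.1)) * (X.1.card : ℝ)
      ≤ ∑ X ∈ univ.filter (fun X : TDom d N => (X.1 ∩ Y).Nonempty), 4 * 2 ^ d * Real.exp (-((δ / 2 - 1) * torusTreeLen X.1)) :=
        sum_le_sum fun X _ => card_mul_exp_le δ X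
    _ = 4 * 2 ^ d * ∑ X ∈ univ.filter (fun X : (tsys d N).Dom => ((tcubeSys d N).cubes X ∩ Y).Nonempty),
          Real.exp (-(δ / 2 - 1) * (tsys d N).dj X) := by
        rw [mul_sum]
        exact sum_congr rfl fun X _ => by rw [TreeLengthTorus.tsys_dj, neg_mul]
    _ ≤ 4 * 2 ^ d * (K₀ (4 * 2 ^ d) (2 * d) * Y.card) := mul_le_mul_of_nonneg_left h126 (by positivity)
    _ = 4 * 2 ^ d * K₀ (4 * 2 ^ d) (2 * d) * Y.card := by ring

end Touch

/-! ## §3  The series of the power members, piece by piece -/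

section Series

variable {S : Type} [Fintype S] [DecidableEq S] {Q : Type} [Fintype Q] [DecidableEq Q]
  {ι : Type} [Fintype ι] [DecidableEq ι]

/-- The (63) coefficient of `Tr Tⁿ`, `n = j + 1`: `((−1)ⁿ∕2n)·R⁻ⁿ` (`R = 2γ₁` in [16]). [cite: Balaban1985UV3, (63) p.271] -/
noncomputable def coef63 (R : ℝ) (j : ℕ) : ℝ := (-1) ^ (j + 1) / (2 * ((j : ℝ) + 1)) * (R ^ (j + 1))⁻¹

/-- `|coef63 R j| ≤ ½ R^{−(j+1)}` for `R > 0`. [cite: Balaban1985UV3, (63) p.271 (bookkeeping)] -/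
theorem abs_coef63_le {R : ℝ} (hR : 0 < R) (j : ℕ) : |coef63 R j| ≤ (1 / 2) * (R ^ (j + 1))⁻¹ := by
  unfold coef63
  rw [abs_mul, abs_div, abs_pow, abs_neg, abs_one, one_pow, abs_of_pos (by positivity : (0 : ℝ) < 2 * ((j : ℝ) + 1)),
    abs_of_pos (by positivity : (0 : ℝ) < (R ^ (j + 1))⁻¹)]
  refine mul_le_mul_of_nonneg_right ?_ (by positivity)
  rw [div_le_iff₀ (by positivity : (0 : ℝ) < 2 * ((j : ℝ) + 1))]
  have : (0 : ℝ) ≤ j := Nat.cast_nonneg j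
  nlinarith

/-- ★ **THE PIECE OF THE CUBE SET `U` IN THE POWER HALF OF (63)**: `Σ_{n≥1} ((−1)ⁿ∕2n) R⁻ⁿ · (piece of U in Tr Tⁿ)`. [cite: Balaban1985UV3, (63) p.272; Balaban1987RG1, (1.7) p.261] -/
noncomputable def powMemberPiece (supp : ι → Finset Q) (T : ι → Matrix S S ℂ) (R : ℝ) (U : Finset Q) : ℂ :=
  ∑' j : ℕ, (coef63 R j : ℂ) * locPowPiece supp T (j + 1) U

variable {d N : ℕ} [NeZero N] {supp : ι → Finset (TPt d N)} {T : ι → Matrix S S ℂ} {cube : S → TPt d N}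

/-- ★★ **TERMWISE BOUND**: under PART B's hypotheses and `2·c·K·e^{δ} ≤ R`, the `j`-th term of the piece of a non-empty `U` is at most `¼ N_U |U| e^{−(δ∕2) d(U)} · (½)^{j}`.
[cite: Balaban1985UV3, (63) p.272, (23) p.262; Balaban1988RG2Cluster, (2.27) p.18, (1.26) p.8] -/
theorem norm_term63_le (hsupp : ∀ i, IsTDom (supp i)) (hTsupp : ∀ i s s', (cube s ∉ supp i ∨ cube s' ∉ supp i) → T i s s' = 0)
    {c δ K R : ℝ} (hc : 0 ≤ c) (hδ : 0 ≤ δ) (hK : 0 ≤ K) (hR : 0 < R) (hRc : 2 * (c * K * Real.exp δ) ≤ R)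
    (hT : ∀ i, ‖T i‖ ≤ c * Real.exp (-(δ * torusTreeLen (supp i))))
    (hcount : ∀ Y : Finset (TPt d N), ∑ i ∈ univ.filter (fun i => (supp i ∩ Y).Nonempty),
      Real.exp (-(δ / 2 * torusTreeLen (supp i))) * (supp i).card ≤ K * Y.card)
    (U : Finset (TPt d N)) (hU : U.Nonempty) (j : ℕ) :
    ‖(coef63 R j : ℂ) * locPowPiece supp T (j + 1) U‖ ≤
      (1 / 4) * (((univ.filter fun s : S => cube s ∈ U).card : ℝ) * U.card * Real.exp (-(δ / 2 * torusTreeLen U))) * (1 / 2) ^ j := by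
  have hpiece := norm_locPowPiece_le_decay (cube := cube) hsupp hTsupp hc hδ hK hT hcount (by omega : 1 ≤ j + 1) U hU
  rw [norm_mul, Complex.norm_real, Real.norm_eq_abs]
  set NU : ℝ := ((univ.filter fun s : S => cube s ∈ U).card : ℝ) with hNU
  set E : ℝ := Real.exp (-(δ / 2 * torusTreeLen U)) with hE
  have hm1 : ((j + 1 : ℕ) : ℝ) - 1 = j := by push_cast; ring
  rw [hm1] at hpiece
  -- the ratio (c K e^δ / R)^{j+1} ≤ (1/2)^{j+1}, and e^{δ j} ≤ e^{δ (j+1)}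
  have hratio : (R ^ (j + 1))⁻¹ * (c ^ (j + 1) * Real.exp (δ * j) * K ^ (j + 1)) ≤ (1 / 2) ^ (j + 1) := by
    have hej : Real.exp (δ * j) ≤ Real.exp δ ^ (j + 1) := by
      rw [← Real.exp_nat_mul]
      exact Real.exp_le_exp.2 (by push_cast; nlinarith)
    have hq : c * K * Real.exp δ / R ≤ 1 / 2 := by
      rw [div_le_iff₀ hR]; linarith
    have hq0 : 0 ≤ c * K * Real.exp δ / R := by positivity
    calc (R ^ (j + 1))⁻¹ * (c ^ (j + 1) * Real.exp (δ * j) * K ^ (j + 1))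
        ≤ (R ^ (j + 1))⁻¹ * (c ^ (j + 1) * Real.exp δ ^ (j + 1) * K ^ (j + 1)) := by
          refine mul_le_mul_of_nonneg_left ?_ (by positivity)
          exact mul_le_mul_of_nonneg_right (mul_le_mul_of_nonneg_left hej (by positivity)) (by positivity)
      _ = (c * K * Real.exp δ / R) ^ (j + 1) := by rw [div_pow, mul_pow, mul_pow, div_eq_inv_mul]; ring
      _ ≤ (1 / 2) ^ (j + 1) := pow_le_pow_left₀ hq0 hq _
  calc |coef63 R j| * ‖locPowPiece supp T (j + 1) U‖
      ≤ ((1 / 2) * (R ^ (j + 1))⁻¹) * (NU * (c ^ (j + 1) * Real.exp (δ * j) * E * (K ^ (j + 1) * U.card))) :=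
        mul_le_mul (abs_coef63_le hR j) hpiece (norm_nonneg _) (by positivity)
    _ = (1 / 2) * (NU * U.card * E) * ((R ^ (j + 1))⁻¹ * (c ^ (j + 1) * Real.exp (δ * j) * K ^ (j + 1))) := by ring
    _ ≤ (1 / 2) * (NU * U.card * E) * (1 / 2) ^ (j + 1) := mul_le_mul_of_nonneg_left hratio (by positivity)
    _ = (1 / 4) * (NU * U.card * E) * (1 / 2) ^ j := by ring

/-- ★★ **SUMMABILITY** of the piece's series (geometric domination). [cite: Balaban1985UV3, (63) p.272] -/
theorem summable_powMemberPiece (hsupp : ∀ i, IsTDom (supp i)) (hTsupp : ∀ i s s', (cube s ∉ supp i ∨ cube s' ∉ supp i) → T i s s' = 0)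
    {c δ K R : ℝ} (hc : 0 ≤ c) (hδ : 0 ≤ δ) (hK : 0 ≤ K) (hR : 0 < R) (hRc : 2 * (c * K * Real.exp δ) ≤ R)
    (hT : ∀ i, ‖T i‖ ≤ c * Real.exp (-(δ * torusTreeLen (supp i))))
    (hcount : ∀ Y : Finset (TPt d N), ∑ i ∈ univ.filter (fun i => (supp i ∩ Y).Nonempty),
      Real.exp (-(δ / 2 * torusTreeLen (supp i))) * (supp i).card ≤ K * Y.card)
    (U : Finset (TPt d N)) : Summable fun j : ℕ => (coef63 R j : ℂ) * locPowPiece supp T (j + 1) U := by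
  by_cases hU : U.Nonempty
  · exact Summable.of_norm_bounded (g := fun j : ℕ => (1 / 4) * (((univ.filter fun s : S => cube s ∈ U).card : ℝ) * U.card * Real.exp (-(δ / 2 * torusTreeLen U))) * (1 / 2) ^ j)
      ((summable_geometric_of_lt_one (by norm_num) (by norm_num : (1 / 2 : ℝ) < 1)).mul_left _)
      (fun j => norm_term63_le hsupp hTsupp hc hδ hK hR hRc hT hcount U hU j)
  · -- the empty set is not a domain: every term vanishes
    rw [not_nonempty_iff_eq_empty] at hU
    have h0 : ∀ j : ℕ, (coef63 R j : ℂ) * locPowPiece supp T (j + 1) U = 0 := fun j => by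
      rw [locPowPiece_eq_zero_of_not_isTDom hsupp (by omega : 1 ≤ j + 1) (by rw [hU]; exact fun h => Finset.not_nonempty_empty h.1), mul_zero]
    simp only [h0]
    exact summable_zero

/-- ★★ **THE PIECE IS EXPONENTIALLY SMALL**: `‖powMemberPiece … U‖ ≤ ½ N_U |U| e^{−(δ∕2) d(U)}` (and `= 0` at the empty set). [cite: Balaban1985UV3, (63) p.272, (25) p.262; Balaban1987RG1, (1.18) p.263] -/
theorem norm_powMemberPiece_le (hsupp : ∀ i, IsTDom (supp i)) (hTsupp : ∀ i s s', (cube s ∉ supp i ∨ cube s' ∉ supp i) → T i s s' = 0)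
    {c δ K R : ℝ} (hc : 0 ≤ c) (hδ : 0 ≤ δ) (hK : 0 ≤ K) (hR : 0 < R) (hRc : 2 * (c * K * Real.exp δ) ≤ R)
    (hT : ∀ i, ‖T i‖ ≤ c * Real.exp (-(δ * torusTreeLen (supp i))))
    (hcount : ∀ Y : Finset (TPt d N), ∑ i ∈ univ.filter (fun i => (supp i ∩ Y).Nonempty),
      Real.exp (-(δ / 2 * torusTreeLen (supp i))) * (supp i).card ≤ K * Y.card)
    (U : Finset (TPt d N)) :
    ‖powMemberPiece supp T R U‖ ≤ (1 / 2) * (((univ.filter fun s : S => cube s ∈ U).card : ℝ) * U.card * Real.exp (-(δ / 2 * torusTreeLen U))) := by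
  unfold powMemberPiece
  by_cases hU : U.Nonempty
  · have hgeo := (hasSum_geometric_of_lt_one (by norm_num) (by norm_num : (1 / 2 : ℝ) < 1)).mul_left
      ((1 / 4) * (((univ.filter fun s : S => cube s ∈ U).card : ℝ) * U.card * Real.exp (-(δ / 2 * torusTreeLen U))))
    refine (tsum_of_norm_bounded hgeo fun j => norm_term63_le hsupp hTsupp hc hδ hK hR hRc hT hcount U hU j).trans (le_of_eq ?_)
    have : ((1 : ℝ) - 1 / 2)⁻¹ = 2 := by norm_num
    rw [this]
    ring
  · rw [not_nonempty_iff_eq_empty] at hU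
    have h0 : ∀ j : ℕ, (coef63 R j : ℂ) * locPowPiece supp T (j + 1) U = 0 := fun j => by
      rw [locPowPiece_eq_zero_of_not_isTDom hsupp (by omega : 1 ≤ j + 1) (by rw [hU]; exact fun h => Finset.not_nonempty_empty h.1), mul_zero]
    simp only [h0, tsum_zero, norm_zero]
    positivity

/-- ★★★ **THE LOCALIZED PIECES RESUM TO THE POWER HALF OF (63)**: `Σ_{X ∈ 𝐃} powMemberPiece … X = Σ_{n≥1} ((−1)ⁿ∕2n) R⁻ⁿ Tr (Σ_i T_i)ⁿ` (PART A termwise, non-domains carry nothing, and the finite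
sum over domains commutes with the absolutely convergent series). [cite: Balaban1985UV3, (63) p.272 («summing the expressions with the same localization X»); Balaban1987RG1, (1.7) p.261] -/
theorem sum_powMemberPiece_eq (hsupp : ∀ i, IsTDom (supp i)) (hTsupp : ∀ i s s', (cube s ∉ supp i ∨ cube s' ∉ supp i) → T i s s' = 0)
    {c δ K R : ℝ} (hc : 0 ≤ c) (hδ : 0 ≤ δ) (hK : 0 ≤ K) (hR : 0 < R) (hRc : 2 * (c * K * Real.exp δ) ≤ R)
    (hT : ∀ i, ‖T i‖ ≤ c * Real.exp (-(δ * torusTreeLen (supp i))))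
    (hcount : ∀ Y : Finset (TPt d N), ∑ i ∈ univ.filter (fun i => (supp i ∩ Y).Nonempty),
      Real.exp (-(δ / 2 * torusTreeLen (supp i))) * (supp i).card ≤ K * Y.card) :
    ∑ X : TDom d N, powMemberPiece supp T R X.1 = ∑' j : ℕ, (coef63 R j : ℂ) * Matrix.trace ((∑ i, T i) ^ (j + 1)) := by
  have hs : ∀ X ∈ (univ : Finset (TDom d N)), Summable (fun j : ℕ => (coef63 R j : ℂ) * locPowPiece supp T (j + 1) X.1) :=
    fun X _ => summable_powMemberPiece (cube := cube) hsupp hTsupp hc hδ hK hR hRc hT hcount X.1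
  have hswap := Summable.tsum_finsetSum hs
  unfold powMemberPiece
  rw [← hswap]
  refine tsum_congr fun j => ?_
  have hA := trace_pow_eq_sum_locPowPiece (cube := cube) (supp := supp) (T := T) hTsupp (j + 1)
  rw [hA, mul_sum]
  -- the sum over all cube sets is the sum over the domains (PART A §6)
  classical
  set f : Finset (TPt d N) → ℂ := fun U => (coef63 R j : ℂ) * locPowPiece supp T (j + 1) U with hf
  have h1 : ∑ U : Finset (TPt d N), f U = ∑ U ∈ univ.filter (fun U : Finset (TPt d N) => IsTDom U), f U := by
    rw [sum_filter_of_ne]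
    intro U _ hU
    by_contra hdom
    exact hU (by rw [hf]; exact mul_eq_zero_of_right _ (locPowPiece_eq_zero_of_not_isTDom hsupp (by omega : 1 ≤ j + 1) hdom))
  have h2 : ∑ U ∈ univ.filter (fun U : Finset (TPt d N) => IsTDom U), f U = ∑ X : TDom d N, f X.1 := by
    refine (Finset.sum_bij (fun (X : TDom d N) _ => X.1) (fun X _ => mem_filter.2 ⟨mem_univ _, X.2⟩) (fun X _ Y _ h => Subtype.ext h)
      (fun U hU => ⟨⟨U, (mem_filter.1 hU).2⟩, mem_univ _, rfl⟩) (fun X _ => rfl)).symm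
  show ∑ X : TDom d N, f X.1 = ∑ U : Finset (TPt d N), f U
  rw [h1, h2]

end Series

end Summit.QuantumFields.YangMills.Theorems.BalabanUVNodesPortS1
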